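import Literature.Probability.LatticeModels.KilledHarmonicRatio
import HarnessLib

/-!
# The hub vertex of a two-sided path and the cross-ratio from a two-sided factorisation
(line `symplectic-fermion-anchor`, crux `SAWLoopFugacityFlow.AvoidanceLimit`, stmt-CriticalPhenomena-10649)

Three elementary bricks of Chelkak's hub factorisation of the exit kernels of the edge-killed walk
(Chelkak 2016, §3, Lemma 3.4 / Theorem 3.5), in the parametric form used by the line:

* `exists_hub_of_chain` — the **discrete intermediate value step**: along a chain `0, …, n` with
  `a 0 ≥ η/5`, `b n ≥ η/5`, `a i + b i ≥ η` and the one-step bound `b (i+1) ≤ 4 b i`, some index has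
  `a i ≥ η/5` and `b i ≥ η/5` (take the LAST index with `a i ≥ η/5`);
* `exists_hub_vertex_zd` — the same along a walk of a subgraph `Gr ≤ ℤ²` for two nonnegative
  killed-superharmonic functions `uT`, `uB` (the harmonic measures of the two lateral sides): every
  edge of the walk is a lattice step, so `uB` changes by a factor at most `4` along it
  (`IsKilledSuperharmonicOn.le_four_mul_of_adj`), and the chain lemma produces the **hub vertex**;
* `crossRatio_le_of_twoSided` — if a kernel is two-sidedly comparable to a product,
  `c f(i) g(k) ≤ P i k ≤ C f(i) g(k)` with `f, g ≥ 0 < c`, then its cross-ratios are bounded: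
  `P i k · P i' k' ≤ (C/c)² · P i' k · P i k'`.

Pure real analysis / `SimpleGraph.Walk` bookkeeping; no definitions. [cite: Chelkak2016, Lemma 3.4]
-/

noncomputable section

open scoped BigOperators Classical
open Finset Literature.Probability.LatticeModels

namespace Summit.CriticalPhenomena.SAWScalingLimit.Theorems.AvoidanceLimit.Anchor

/-- **Hub index (parametric discrete intermediate value step).** Let `a, b : ℕ → ℝ`, `η > 0`, with
`a 0 ≥ η/5`, `b n ≥ η/5`, `a i + b i ≥ η` for `i ≤ n` and `b (i+1) ≤ 4 b i` for `i < n`. Then some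
`i ≤ n` has `a i ≥ η/5` and `b i ≥ η/5`: the last index `i` with `a i ≥ η/5` works, since either
`i = n`, or `a (i+1) < η/5` forces `b (i+1) > 4η/5` and hence `b i ≥ b (i+1) / 4 > η/5`.
[cite: Chelkak2016, Lemma 3.4] -/
theorem exists_hub_of_chain :
    ∀ (n : ℕ) (a b : ℕ → ℝ) (η : ℝ), 0 < η → η / 5 ≤ a 0 → η / 5 ≤ b n →
      (∀ i, i ≤ n → η ≤ a i + b i) → (∀ i, i < n → b i.succ ≤ 4 * b i) →
      ∃ i, i ≤ n ∧ η / 5 ≤ a i ∧ η / 5 ≤ b i := by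
  intro n a b η _hη ha0 hbn hsum hstep
  -- the last index `m ≤ n` with `η / 5 ≤ a m`
  set m := Nat.findGreatest (fun i => η / 5 ≤ a i) n with hm
  have hmn : m ≤ n := Nat.findGreatest_le n
  have ham : η / 5 ≤ a m := Nat.findGreatest_spec (P := fun i => η / 5 ≤ a i) (Nat.zero_le n) ha0
  rcases hmn.eq_or_lt with hmeq | hmlt
  · exact ⟨m, hmn, ham, hmeq ▸ hbn⟩
  · -- `m < n`: the next index fails the predicate, so `b (m+1)` is large, hence so is `b m`
    have hnot : ¬ η / 5 ≤ a (m + 1) :=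
      Nat.findGreatest_is_greatest (P := fun i => η / 5 ≤ a i) (Nat.lt_succ_self m) hmlt
    have hs := hsum (m + 1) hmlt
    have hst := hstep m hmlt
    refine ⟨m, hmn, ham, ?_⟩
    push Not at hnot
    linarith

/-- **Hub vertex.** Let `Gr ≤ ℤ²`, `uT, uB ≥ 0` killed-superharmonic for the `Gr`-walk on `Λ`, and
`p` a `Gr`-walk inside `Λ` from `x` with `uT x ≥ η/5` to `y` with `uB y ≥ η/5` along which
`uT + uB ≥ η`. Then some vertex `z` of `p` has `uT z ≥ η/5` and `uB z ≥ η/5` (a vertex "seeing both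
sides"). Every edge of `p` is a lattice step `v → v + e`, along which `uB (v + e) ≤ 4 uB v`
(`IsKilledSuperharmonicOn.le_four_mul_of_adj`), so this is `exists_hub_of_chain` for
`a i = uT (p i)`, `b i = uB (p i)`. (For a graph with a non-lattice edge the statement fails: the
killed average only sees the four lattice directions.) [cite: Chelkak2016, Lemma 3.4] -/
theorem exists_hub_vertex_zd :
    ∀ (Gr : SimpleGraph (Site 2)) (Λ : Set (Site 2)) (uT uB : Site 2 → ℝ) (η : ℝ), Gr ≤ zdGraph 2 → 0 < η →
      (∀ z, 0 ≤ uT z) → (∀ z, 0 ≤ uB z) →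
      IsKilledSuperharmonicOn Gr uT Λ → IsKilledSuperharmonicOn Gr uB Λ →
      ∀ {x y : Site 2} (p : Gr.Walk x y), (∀ z ∈ p.support, z ∈ Λ) →
      η / 5 ≤ uT x → η / 5 ≤ uB y → (∀ z ∈ p.support, η ≤ uT z + uB z) →
      ∃ z ∈ p.support, η / 5 ≤ uT z ∧ η / 5 ≤ uB z := by
  intro Gr Λ uT uB η hGr hη _huT huB _hT hB x y p hpΛ hx hy hsum
  -- the chain of values along the walk
  have hstep : ∀ i, i < p.length → uB (p.getVert i.succ) ≤ 4 * uB (p.getVert i) := by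
    intro i hi
    have hadj : Gr.Adj (p.getVert i) (p.getVert (i + 1)) := p.adj_getVert_succ hi
    obtain ⟨e, he⟩ := SRW.exists_dir_of_adj (hGr hadj)
    have hadj' : Gr.Adj (p.getVert i) (p.getVert i + SRW.stepVec e) := he ▸ hadj
    have := hB.le_four_mul_of_adj huB (hpΛ _ (p.getVert_mem_support i)) hadj'
    rwa [← he] at this
  obtain ⟨i, _hin, hai, hbi⟩ := exists_hub_of_chain p.length (fun i => uT (p.getVert i))
    (fun i => uB (p.getVert i)) η hη (by simpa using hx) (by simpa using hy)
    (fun i _ => hsum _ (p.getVert_mem_support i)) hstep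
  exact ⟨p.getVert i, p.getVert_mem_support i, hai, hbi⟩

/-- **Cross-ratio bound from a two-sided factorisation.** If `c f(i) g(k) ≤ P i k ≤ C f(i) g(k)` for
all `i, k`, with `c > 0` and `f, g ≥ 0`, then `P i k · P i' k' ≤ (C/c)² · (P i' k · P i k')` for all
`i, i', k, k'`: both `P i k · P i' k'` and `P i' k · P i k'` are compared with the same product
`f(i) f(i') g(k) g(k')`, from above with `C²` and from below with `c²`. [cite: Chelkak2016, Lemma 3.4] -/
theorem crossRatio_le_of_twoSided :
    ∀ (P : Site 2 → Site 2 → ℝ) (f g : Site 2 → ℝ) (c C : ℝ), 0 < c →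
      (∀ i k, c * (f i * g k) ≤ P i k) → (∀ i k, P i k ≤ C * (f i * g k)) →
      (∀ i, 0 ≤ f i) → (∀ k, 0 ≤ g k) →
      ∀ i i' k k', P i k * P i' k' ≤ (C / c) ^ 2 * (P i' k * P i k') := by
  intro P f g c C hc hlo hup hf hg i i' k k'
  -- `P ≥ 0` from the lower bound
  have hP0 : ∀ j l, 0 ≤ P j l := fun j l =>
    le_trans (mul_nonneg hc.le (mul_nonneg (hf j) (hg l))) (hlo j l)
  calc P i k * P i' k' ≤ (C * (f i * g k)) * (C * (f i' * g k')) :=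
        mul_le_mul (hup i k) (hup i' k') (hP0 i' k') (le_trans (hP0 i k) (hup i k))
    _ = (C / c) ^ 2 * ((c * (f i' * g k)) * (c * (f i * g k'))) := by
        rw [div_pow]
        field_simp
    _ ≤ (C / c) ^ 2 * (P i' k * P i k') :=
        mul_le_mul_of_nonneg_left
          (mul_le_mul (hlo i' k) (hlo i k') (mul_nonneg hc.le (mul_nonneg (hf i) (hg k'))) (hP0 i' k))
          (sq_nonneg _)

end Summit.CriticalPhenomena.SAWScalingLimit.Theorems.AvoidanceLimit.Anchor

end
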